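import Mathlib
import Literature.Analysis.Calculus.TwoVariablePartials
import Literature.Analysis.PDE.Wave1DTrapezoidEnergy
import HarnessLib

/-!
# Null-separated multipliers for `ψ_tt − ψ_xx + V(x)ψ = 0`: the divergence identity on
# characteristic trapezoids

Analysis/PDE support file (everything proved, no definitions). The vector fields
`Z = α(u)∂_u + β(v)∂_v` (`u = t − x`, `v = t + x`, `α, β` arbitrary `C¹` functions of ONE null
variable) are exactly the conformal Killing fields of `1+1` Minkowski space, and for them the
deformation-tensor bulk of the multiplier identity contains no first-order terms: for a `C²` solution
of `ψ_tt − ψ_xx + V(x)ψ = 0` with `V ∈ C¹`, writing `p = ψ_t`, `q = ψ_x`, `a = α(t − x)`,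
`b = β(t + x)`,

* `E_Z = b (p + q)² + a (p − q)² + (a + b) V ψ²` (the `Z`-energy density, `= 2e` for `α = β = 1`),
* `M_Z = b (p + q)² − a (p − q)² + (a − b) V ψ²` (the `Z`-momentum density, `= 2m = 4pq` for
  `α = β = 1`),

one has the pointwise law `∂_t E_Z − ∂_x M_Z = 2(α′(t−x) + β′(t+x)) V ψ² + (b − a) V′ ψ²`
(`hasDerivAt_nullEnergy_fst`, `hasDerivAt_nullMomentum_snd`). Integrated over the characteristic
trapezoid `{s ≤ τ ≤ t, a + τ ≤ x ≤ b − τ}` (`wave1D_nullMultiplier_trapezoid_identity`) this gives the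
`Z`-energy on the top, minus the `Z`-energy on the base, as minus two NON-NEGATIVE characteristic
fluxes (`2β(2x−a)(p+q)² + 2α(−a)Vψ²` through the left edge, `2α(b−2x)(p−q)² + 2β(b)Vψ²` through the
right edge, when `α, β, V ≥ 0`) plus the signed bulk. The general first-order form
`trapezoid_divergence_identity` (any `C¹` pair `(E, M)` with `∂_τ E = ∂ₓ M + S`) extends
`trapezoid_energy_identity` of `Wave1DTrapezoidEnergy.lean` by a continuous source.

Use (route PhotonSphereChannels, crux `WindowedShellChannels`, stmt-FinalStateConjecture-14085): with
`α` constant and `β` a logistic profile in `v` the bulk is signed wherever `V′ ≥ 2κ′V`, which is the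
horizon side of the Regge–Wheeler potentials; the right-edge flux then controls the energy a
horizon-side datum loses behind a lagged null line (`Wave1DNearWindowedChannel.lean`).

References: S. Alinhac, *Hyperbolic Partial Differential Equations* (2009), §2.2 and Ch. 6
(multiplier identities); S. Klainerman's vector-field method; the null-separated family is folklore
(conformal invariance of the `1+1` wave operator). Recorded as folklore.
-/

noncomputable section

namespace Literature.Analysis.PDE

open MeasureTheory Set Filter Topology intervalIntegral Literature.Analysis.Calculus

/-! ### A divergence identity with source on characteristic trapezoids -/

/-- **Divergence identity with source on a characteristic trapezoid** (first-order form). Let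
`E, M, G, S` be jointly continuous functions of `(τ, x)` with `∂_τ E(τ,x) = G(τ,x) + S(τ,x)` and
`∂ₓ M(τ,x) = G(τ,x)` (so that `∂_τ E − ∂ₓ M = S`). Then for `s ≤ t` and `a + t ≤ b − t`
`∫_{a+t}^{b−t} E(t,·) − ∫_{a+s}^{b−s} E(s,·)
   = −∫_{a+s}^{a+t} (E + M)(x − a, x) dx − ∫_{b−t}^{b−s} (E − M)(b − x, x) dx + ∫_s^t ∫_{a+τ}^{b−τ} S`:
the density on the top of the trapezoid `{s ≤ τ ≤ t, a + τ ≤ x ≤ b − τ}` equals the density on its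
base minus the two characteristic fluxes plus the bulk. (Fubini on the trapezoid in both orders and
the fundamental theorem of calculus; `trapezoid_energy_identity` is the case `S = 0`.) [folklore] -/
theorem trapezoid_divergence_identity {E M G S : ℝ → ℝ → ℝ}
    (hE : Continuous (Function.uncurry E)) (hM : Continuous (Function.uncurry M))
    (hG : Continuous (Function.uncurry G)) (hS : Continuous (Function.uncurry S))
    (hEd : ∀ x τ, HasDerivAt (fun τ => E τ x) (G τ x + S τ x) τ)
    (hMd : ∀ τ x, HasDerivAt (fun y => M τ y) (G τ x) x)
    {a b s t : ℝ} (hst : s ≤ t) (hab : a + t ≤ b - t) :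
    (∫ x in (a + t)..(b - t), E t x) - ∫ x in (a + s)..(b - s), E s x
      = -(∫ x in (a + s)..(a + t), (E (x - a) x + M (x - a) x))
        - (∫ x in (b - t)..(b - s), (E (b - x) x - M (b - x) x))
        + ∫ τ in s..t, ∫ x in (a + τ)..(b - τ), S τ x := by
  -- continuity bookkeeping
  have hcont2 : ∀ {φ : ℝ → ℝ → ℝ}, Continuous (Function.uncurry φ) →
      ∀ {u v : ℝ → ℝ}, Continuous u → Continuous v → Continuous fun y => φ (u y) (v y) :=
    fun hφ u v hu hv => hφ.comp (hu.prodMk hv)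
  set g : ℝ → ℝ → ℝ := fun τ x => G τ x + S τ x with hg_def
  have hg_cont : Continuous (Function.uncurry g) := by
    show Continuous fun p : ℝ × ℝ => G p.1 p.2 + S p.1 p.2
    have ha : Continuous fun p : ℝ × ℝ => G p.1 p.2 := hG
    have hb : Continuous fun p : ℝ × ℝ => S p.1 p.2 := hS
    fun_prop
  -- Fubini on the trapezoid for `g = ∂_τ E`
  have hswap := trapezoid_integral_swap (G := Function.uncurry g) hg_cont hst hab
  simp only [Function.uncurry_apply_pair] at hswap
  -- inner integrals
  have hinner1 : ∀ τ, (∫ x in (a + τ)..(b - τ), g τ x)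
      = (M τ (b - τ) - M τ (a + τ)) + ∫ x in (a + τ)..(b - τ), S τ x := by
    intro τ
    have h1 : (∫ x in (a + τ)..(b - τ), G τ x) = M τ (b - τ) - M τ (a + τ) :=
      integral_eq_sub_of_hasDerivAt (fun x _ => hMd τ x)
        ((hcont2 hG continuous_const continuous_id).intervalIntegrable _ _)
    rw [← h1]
    exact integral_add ((hcont2 hG continuous_const continuous_id).intervalIntegrable _ _)
      ((hcont2 hS continuous_const continuous_id).intervalIntegrable _ _)
  have hinner2 : ∀ x m, (∫ τ in s..m, g τ x) = E m x - E s x := by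
    intro x m
    refine integral_eq_sub_of_hasDerivAt (fun τ _ => hEd x τ) ?_
    exact ((hcont2 hg_cont continuous_id continuous_const).intervalIntegrable _ _)
  simp_rw [hinner1, hinner2] at hswap
  -- the bulk `τ ↦ ∫_{a+τ}^{b-τ} S(τ,·)` is continuous
  have hbulk_cont : Continuous fun τ => ∫ x in (a + τ)..(b - τ), S τ x := by
    have h1 : Continuous fun τ => ∫ x in (0 : ℝ)..(b - τ), S τ x :=
      intervalIntegral.continuous_parametric_intervalIntegral_of_continuous hS
        (continuous_const.sub continuous_id)
    have h2 : Continuous fun τ => ∫ x in (0 : ℝ)..(a + τ), S τ x :=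
      intervalIntegral.continuous_parametric_intervalIntegral_of_continuous hS
        (continuous_const.add continuous_id)
    have heq : (fun τ => ∫ x in (a + τ)..(b - τ), S τ x)
        = fun τ => (∫ x in (0 : ℝ)..(b - τ), S τ x) - ∫ x in (0 : ℝ)..(a + τ), S τ x := by
      funext τ
      rw [integral_interval_sub_left]
      · exact (hcont2 hS continuous_const continuous_id).intervalIntegrable _ _
      · exact (hcont2 hS continuous_const continuous_id).intervalIntegrable _ _
    rw [heq]
    exact h1.sub h2
  -- left side of `hswap`: the two characteristic fluxes, reparametrised by `x`, plus the bulk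
  have hL : (∫ τ in s..t, ((M τ (b - τ) - M τ (a + τ)) + ∫ x in (a + τ)..(b - τ), S τ x))
      = ((∫ x in (b - t)..(b - s), M (b - x) x) - ∫ x in (a + s)..(a + t), M (x - a) x)
        + ∫ τ in s..t, ∫ x in (a + τ)..(b - τ), S τ x := by
    have c1 : Continuous fun τ => M τ (b - τ) :=
      hcont2 hM continuous_id (continuous_const.sub continuous_id)
    have c2 : Continuous fun τ => M τ (a + τ) :=
      hcont2 hM continuous_id (continuous_const.add continuous_id)
    have i12 : IntervalIntegrable (fun τ => M τ (b - τ) - M τ (a + τ)) volume s t :=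
      ((c1.sub c2 : Continuous fun τ => M τ (b - τ) - M τ (a + τ))).intervalIntegrable _ _
    have i3 : IntervalIntegrable (fun τ => ∫ x in (a + τ)..(b - τ), S τ x) volume s t :=
      hbulk_cont.intervalIntegrable _ _
    have i1 : IntervalIntegrable (fun τ => M τ (b - τ)) volume s t := c1.intervalIntegrable _ _
    have i2 : IntervalIntegrable (fun τ => M τ (a + τ)) volume s t := c2.intervalIntegrable _ _
    rw [integral_add i12 i3]
    congr 1
    rw [integral_sub i1 i2]
    congr 1
    · rw [← integral_comp_sub_left (fun x => M (b - x) x) b]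
      simp
    · rw [show a + s = s + a by ring, show a + t = t + a by ring,
        ← integral_comp_add_right (fun x => M (x - a) x) a]
      simp [add_comm]
  -- right side of `hswap`: split `[a + s, b - s]` into three pieces
  set m : ℝ → ℝ := fun x => min t (min (x - a) (b - x)) with hm_def
  have hm_cont : Continuous m := by
    simp only [hm_def]; fun_prop
  have htop_cont : Continuous fun x => E (m x) x := hcont2 hE hm_cont continuous_id
  have hii : ∀ u v, IntervalIntegrable (fun x => E (m x) x) volume u v :=
    fun u v => htop_cont.intervalIntegrable u v
  have hR : (∫ x in (a + s)..(b - s), (E (m x) x - E s x))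
      = (∫ x in (a + s)..(a + t), E (x - a) x) + (∫ x in (a + t)..(b - t), E t x)
        + (∫ x in (b - t)..(b - s), E (b - x) x) - ∫ x in (a + s)..(b - s), E s x := by
    have c3 : Continuous fun x => E s x := hcont2 hE continuous_const continuous_id
    rw [integral_sub (hii _ _) (c3.intervalIntegrable _ _)]
    congr 1
    rw [← integral_add_adjacent_intervals (hii (a + s) (a + t)) (hii (a + t) (b - s)),
      ← integral_add_adjacent_intervals (hii (a + t) (b - t)) (hii (b - t) (b - s))]
    have e1 : (∫ x in (a + s)..(a + t), E (m x) x) = ∫ x in (a + s)..(a + t), E (x - a) x := by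
      refine integral_congr fun x hx => ?_
      rw [uIcc_of_le (by linarith)] at hx
      have : m x = x - a := by
        simp only [hm_def]
        rw [min_eq_right_iff.2, min_eq_left]
        · linarith [hx.2]
        · exact min_le_of_left_le (by linarith [hx.2])
      simp only [this]
    have e2 : (∫ x in (a + t)..(b - t), E (m x) x) = ∫ x in (a + t)..(b - t), E t x := by
      refine integral_congr fun x hx => ?_
      rw [uIcc_of_le hab] at hx
      have : m x = t := by
        simp only [hm_def]
        exact min_eq_left (le_min (by linarith [hx.1]) (by linarith [hx.2]))
      simp only [this]
    have e3 : (∫ x in (b - t)..(b - s), E (m x) x) = ∫ x in (b - t)..(b - s), E (b - x) x := by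
      refine integral_congr fun x hx => ?_
      rw [uIcc_of_le (by linarith)] at hx
      have : m x = b - x := by
        simp only [hm_def]
        rw [min_eq_right_iff.2, min_eq_right]
        · linarith [hx.1]
        · exact min_le_of_right_le (by linarith [hx.1])
      simp only [this]
    rw [e1, e2, e3]
    ring
  rw [hL, hR] at hswap
  -- regroup the edge integrals
  have hA : (∫ x in (a + s)..(a + t), (E (x - a) x + M (x - a) x))
      = (∫ x in (a + s)..(a + t), E (x - a) x) + ∫ x in (a + s)..(a + t), M (x - a) x := by
    have c4 : Continuous fun x => E (x - a) x :=
      hcont2 hE (continuous_id.sub continuous_const) continuous_id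
    have c5 : Continuous fun x => M (x - a) x :=
      hcont2 hM (continuous_id.sub continuous_const) continuous_id
    rw [← integral_add (c4.intervalIntegrable _ _) (c5.intervalIntegrable _ _)]
  have hC : (∫ x in (b - t)..(b - s), (E (b - x) x - M (b - x) x))
      = (∫ x in (b - t)..(b - s), E (b - x) x) - ∫ x in (b - t)..(b - s), M (b - x) x := by
    have c6 : Continuous fun x => E (b - x) x :=
      hcont2 hE (continuous_const.sub continuous_id) continuous_id
    have c7 : Continuous fun x => M (b - x) x :=
      hcont2 hM (continuous_const.sub continuous_id) continuous_id
    rw [← integral_sub (c6.intervalIntegrable _ _) (c7.intervalIntegrable _ _)]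
  rw [hA, hC]
  linarith

/-! ### The null-multiplier densities of a `C²` solution: pointwise laws -/

section Pointwise

variable {V α β : ℝ → ℝ} {ψ ψt ψx ψtt ψtx ψxx : ℝ → ℝ → ℝ}

/-- **Time derivative of the `Z`-energy density.** First-order form: with `∂_τ ψ = ψt`,
`∂ₓ ψ = ψx`, `∂_τ ψt = ψxx − Vψ` (the equation), `∂_τ ψx = ψtx`, and `C¹` weights `α, β`,
the slice `τ ↦ E_Z(τ, x)`,
`E_Z = β(τ+x)(ψt+ψx)² + α(τ−x)(ψt−ψx)² + (α(τ−x)+β(τ+x)) V ψ²`, has the displayed derivative.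
[folklore] -/
theorem hasDerivAt_nullEnergy_fst (hα : ∀ y, HasDerivAt α (deriv α y) y)
    (hβ : ∀ y, HasDerivAt β (deriv β y) y)
    (h1 : ∀ t x, HasDerivAt (fun τ => ψ τ x) (ψt t x) t)
    (h3 : ∀ t x, HasDerivAt (fun τ => ψt τ x) (ψxx t x - V x * ψ t x) t)
    (h4 : ∀ t x, HasDerivAt (fun τ => ψx τ x) (ψtx t x) t) (t x : ℝ) :
    HasDerivAt (fun τ => β (τ + x) * (ψt τ x + ψx τ x) ^ 2 + α (τ - x) * (ψt τ x - ψx τ x) ^ 2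
        + (α (τ - x) + β (τ + x)) * V x * ψ τ x ^ 2)
      (deriv β (t + x) * (ψt t x + ψx t x) ^ 2
        + β (t + x) * (2 * (ψt t x + ψx t x) * ((ψxx t x - V x * ψ t x) + ψtx t x))
        + (deriv α (t - x) * (ψt t x - ψx t x) ^ 2
          + α (t - x) * (2 * (ψt t x - ψx t x) * ((ψxx t x - V x * ψ t x) - ψtx t x)))
        + ((deriv α (t - x) + deriv β (t + x)) * V x * ψ t x ^ 2
          + (α (t - x) + β (t + x)) * V x * (2 * ψ t x * ψt t x))) t := by
  have hb : HasDerivAt (fun τ => β (τ + x)) (deriv β (t + x) * 1) t :=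
    (hβ (t + x)).comp t ((hasDerivAt_id t).add_const x)
  have ha : HasDerivAt (fun τ => α (τ - x)) (deriv α (t - x) * 1) t :=
    (hα (t - x)).comp t ((hasDerivAt_id t).sub_const x)
  have hsum : HasDerivAt (fun τ => ψt τ x + ψx τ x) ((ψxx t x - V x * ψ t x) + ψtx t x) t :=
    (h3 t x).add (h4 t x)
  have hdif : HasDerivAt (fun τ => ψt τ x - ψx τ x) ((ψxx t x - V x * ψ t x) - ψtx t x) t :=
    (h3 t x).sub (h4 t x)
  have hT := ((hb.mul (hsum.pow 2)).add (ha.mul (hdif.pow 2))).add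
    (((ha.add hb).mul_const (V x)).mul ((h1 t x).pow 2))
  refine hT.congr_deriv ?_
  simp only [Pi.pow_apply, Pi.add_apply]
  push_cast
  ring

/-- **Space derivative of the `Z`-momentum density.** First-order form: with `∂ₓ ψ = ψx`,
`∂ₓ ψt = ψtx`, `∂ₓ ψx = ψxx`, `V ∈ C¹` and `C¹` weights, the slice `y ↦ M_Z(t, y)`,
`M_Z = β(t+y)(ψt+ψx)² − α(t−y)(ψt−ψx)² + (α(t−y) − β(t+y)) V ψ²`, has the displayed derivative.
[folklore] -/
theorem hasDerivAt_nullMomentum_snd (hV : ∀ y, HasDerivAt V (deriv V y) y)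
    (hα : ∀ y, HasDerivAt α (deriv α y) y) (hβ : ∀ y, HasDerivAt β (deriv β y) y)
    (h2 : ∀ t x, HasDerivAt (ψ t) (ψx t x) x)
    (h5 : ∀ t x, HasDerivAt (ψt t) (ψtx t x) x) (h6 : ∀ t x, HasDerivAt (ψx t) (ψxx t x) x)
    (t x : ℝ) :
    HasDerivAt (fun y => β (t + y) * (ψt t y + ψx t y) ^ 2 - α (t - y) * (ψt t y - ψx t y) ^ 2
        + (α (t - y) - β (t + y)) * V y * ψ t y ^ 2)
      (deriv β (t + x) * (ψt t x + ψx t x) ^ 2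
        + β (t + x) * (2 * (ψt t x + ψx t x) * (ψtx t x + ψxx t x))
        - (-deriv α (t - x) * (ψt t x - ψx t x) ^ 2
          + α (t - x) * (2 * (ψt t x - ψx t x) * (ψtx t x - ψxx t x)))
        + (((-deriv α (t - x) - deriv β (t + x)) * V x + (α (t - x) - β (t + x)) * deriv V x)
            * ψ t x ^ 2
          + (α (t - x) - β (t + x)) * V x * (2 * ψ t x * ψx t x))) x := by
  have hb : HasDerivAt (fun y => β (t + y)) (deriv β (t + x) * 1) x :=
    (hβ (t + x)).comp x ((hasDerivAt_id x).const_add t)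
  have ha : HasDerivAt (fun y => α (t - y)) (deriv α (t - x) * -1) x :=
    (hα (t - x)).comp x ((hasDerivAt_id x).const_sub t)
  have hsum : HasDerivAt (fun y => ψt t y + ψx t y) (ψtx t x + ψxx t x) x := (h5 t x).add (h6 t x)
  have hdif : HasDerivAt (fun y => ψt t y - ψx t y) (ψtx t x - ψxx t x) x := (h5 t x).sub (h6 t x)
  have hT := ((hb.mul (hsum.pow 2)).sub (ha.mul (hdif.pow 2))).add
    (((ha.sub hb).mul (hV x)).mul ((h2 t x).pow 2))
  refine hT.congr_deriv ?_
  simp only [Pi.pow_apply, Pi.mul_apply, Pi.sub_apply]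
  push_cast
  ring

end Pointwise

/-! ### The null-multiplier identity on characteristic trapezoids -/

section Solutions

variable {V α β : ℝ → ℝ} {ψ : ℝ → ℝ → ℝ}

/-- **Null-multiplier identity on a characteristic trapezoid.** Let `V, α, β ∈ C¹(ℝ)` and let `ψ`
be a `C²` solution of `ψ_tt − ψ_xx + V(x)ψ = 0` on `ℝ²` (written with `iteratedDeriv 2` in each
variable). With `p = ψ_t`, `q = ψ_x` and the `Z`-energy density
`E_Z(τ,x) = β(τ+x)(p+q)² + α(τ−x)(p−q)² + (α(τ−x)+β(τ+x)) V ψ²` of the null-separated multiplier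
`Z = α(t−x)∂_u + β(t+x)∂_v`, for `s ≤ t` and `a + t ≤ b − t`:
`∫_{a+t}^{b−t} E_Z(t,·) − ∫_{a+s}^{b−s} E_Z(s,·) = −∫_{a+s}^{a+t} [2β(2x−a)(p+q)² + 2α(−a)Vψ²](x−a,x) dx`
`  − ∫_{b−t}^{b−s} [2α(b−2x)(p−q)² + 2β(b)Vψ²](b−x,x) dx`
`  + ∫_s^t ∫_{a+τ}^{b−τ} [2(α′(τ−x) + β′(τ+x)) V + (β(τ+x) − α(τ−x)) V′] ψ² dx dτ`.
For `α = β = 1` this is twice `wave1D_trapezoid_energy_identity`. [folklore] -/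
theorem wave1D_nullMultiplier_trapezoid_identity (hV : ContDiff ℝ 1 V) (hα : ContDiff ℝ 1 α)
    (hβ : ContDiff ℝ 1 β) (hψ : ContDiff ℝ 2 (Function.uncurry ψ))
    (hsol : ∀ t x, iteratedDeriv 2 (fun τ => ψ τ x) t - iteratedDeriv 2 (ψ t) x + V x * ψ t x = 0)
    {a b s t : ℝ} (hst : s ≤ t) (hab : a + t ≤ b - t) :
    (∫ x in (a + t)..(b - t),
        (β (t + x) * (deriv (fun τ => ψ τ x) t + deriv (ψ t) x) ^ 2
          + α (t - x) * (deriv (fun τ => ψ τ x) t - deriv (ψ t) x) ^ 2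
          + (α (t - x) + β (t + x)) * V x * ψ t x ^ 2))
      - ∫ x in (a + s)..(b - s),
        (β (s + x) * (deriv (fun τ => ψ τ x) s + deriv (ψ s) x) ^ 2
          + α (s - x) * (deriv (fun τ => ψ τ x) s - deriv (ψ s) x) ^ 2
          + (α (s - x) + β (s + x)) * V x * ψ s x ^ 2)
    = -(∫ x in (a + s)..(a + t),
          (2 * β (2 * x - a) * (deriv (fun τ => ψ τ x) (x - a) + deriv (ψ (x - a)) x) ^ 2
            + 2 * α (-a) * V x * ψ (x - a) x ^ 2))
      - (∫ x in (b - t)..(b - s),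
          (2 * α (b - 2 * x) * (deriv (fun τ => ψ τ x) (b - x) - deriv (ψ (b - x)) x) ^ 2
            + 2 * β b * V x * ψ (b - x) x ^ 2))
      + ∫ τ in s..t, ∫ x in (a + τ)..(b - τ),
          ((2 * (deriv α (τ - x) + deriv β (τ + x)) * V x
            + (β (τ + x) - α (τ - x)) * deriv V x) * ψ τ x ^ 2) := by
  obtain ⟨ψt, ψx, ψtt, ψtx, ψxx, hct, hcx, -, hctx, hcxx, h1, h2, h3, h4, h5, h6, h7, h8⟩ :=
    exists_partials_of_contDiff_two hψ
  have h3' : ∀ t x, HasDerivAt (fun τ => ψt τ x) (ψxx t x - V x * ψ t x) t := by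
    intro t x
    refine (h3 t x).congr_deriv ?_
    have := hsol t x
    rw [h7, h8] at this
    linarith
  have hd1 : ∀ t x, deriv (fun τ => ψ τ x) t = ψt t x := fun t x => (h1 t x).deriv
  have hd2 : ∀ t x, deriv (ψ t) x = ψx t x := fun t x => (h2 t x).deriv
  simp only [hd1, hd2]
  -- one-variable regularity
  have hVd : ∀ y, HasDerivAt V (deriv V y) y := fun y =>
    ((hV.differentiable (by norm_num)) y).hasDerivAt
  have hαd : ∀ y, HasDerivAt α (deriv α y) y := fun y =>
    ((hα.differentiable (by norm_num)) y).hasDerivAt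
  have hβd : ∀ y, HasDerivAt β (deriv β y) y := fun y =>
    ((hβ.differentiable (by norm_num)) y).hasDerivAt
  have hVc : Continuous V := hV.continuous
  have hV'c : Continuous (deriv V) := hV.continuous_deriv (by norm_num)
  have hαc : Continuous α := hα.continuous
  have hα'c : Continuous (deriv α) := hα.continuous_deriv (by norm_num)
  have hβc : Continuous β := hβ.continuous
  have hβ'c : Continuous (deriv β) := hβ.continuous_deriv (by norm_num)
  have hψc : Continuous (Function.uncurry ψ) := hψ.continuous
  -- the densities
  set E : ℝ → ℝ → ℝ := fun τ x => β (τ + x) * (ψt τ x + ψx τ x) ^ 2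
    + α (τ - x) * (ψt τ x - ψx τ x) ^ 2 + (α (τ - x) + β (τ + x)) * V x * ψ τ x ^ 2 with hE_def
  set M : ℝ → ℝ → ℝ := fun τ x => β (τ + x) * (ψt τ x + ψx τ x) ^ 2
    - α (τ - x) * (ψt τ x - ψx τ x) ^ 2 + (α (τ - x) - β (τ + x)) * V x * ψ τ x ^ 2 with hM_def
  set G : ℝ → ℝ → ℝ := fun τ x => deriv β (τ + x) * (ψt τ x + ψx τ x) ^ 2
    + β (τ + x) * (2 * (ψt τ x + ψx τ x) * (ψtx τ x + ψxx τ x))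
    - (-deriv α (τ - x) * (ψt τ x - ψx τ x) ^ 2
      + α (τ - x) * (2 * (ψt τ x - ψx τ x) * (ψtx τ x - ψxx τ x)))
    + (((-deriv α (τ - x) - deriv β (τ + x)) * V x + (α (τ - x) - β (τ + x)) * deriv V x)
        * ψ τ x ^ 2
      + (α (τ - x) - β (τ + x)) * V x * (2 * ψ τ x * ψx τ x)) with hG_def
  set S : ℝ → ℝ → ℝ := fun τ x => (2 * (deriv α (τ - x) + deriv β (τ + x)) * V x
    + (β (τ + x) - α (τ - x)) * deriv V x) * ψ τ x ^ 2 with hS_def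
  -- continuity
  have hψ' : Continuous fun p : ℝ × ℝ => ψ p.1 p.2 := hψc
  have hψt' : Continuous fun p : ℝ × ℝ => ψt p.1 p.2 := hct
  have hψx' : Continuous fun p : ℝ × ℝ => ψx p.1 p.2 := hcx
  have hψtx' : Continuous fun p : ℝ × ℝ => ψtx p.1 p.2 := hctx
  have hψxx' : Continuous fun p : ℝ × ℝ => ψxx p.1 p.2 := hcxx
  have hE_cont : Continuous (Function.uncurry E) := by
    show Continuous fun p : ℝ × ℝ => β (p.1 + p.2) * (ψt p.1 p.2 + ψx p.1 p.2) ^ 2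
      + α (p.1 - p.2) * (ψt p.1 p.2 - ψx p.1 p.2) ^ 2
      + (α (p.1 - p.2) + β (p.1 + p.2)) * V p.2 * ψ p.1 p.2 ^ 2
    fun_prop
  have hM_cont : Continuous (Function.uncurry M) := by
    show Continuous fun p : ℝ × ℝ => β (p.1 + p.2) * (ψt p.1 p.2 + ψx p.1 p.2) ^ 2
      - α (p.1 - p.2) * (ψt p.1 p.2 - ψx p.1 p.2) ^ 2
      + (α (p.1 - p.2) - β (p.1 + p.2)) * V p.2 * ψ p.1 p.2 ^ 2
    fun_prop
  have hG_cont : Continuous (Function.uncurry G) := by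
    show Continuous fun p : ℝ × ℝ => deriv β (p.1 + p.2) * (ψt p.1 p.2 + ψx p.1 p.2) ^ 2
      + β (p.1 + p.2) * (2 * (ψt p.1 p.2 + ψx p.1 p.2) * (ψtx p.1 p.2 + ψxx p.1 p.2))
      - (-deriv α (p.1 - p.2) * (ψt p.1 p.2 - ψx p.1 p.2) ^ 2
        + α (p.1 - p.2) * (2 * (ψt p.1 p.2 - ψx p.1 p.2) * (ψtx p.1 p.2 - ψxx p.1 p.2)))
      + (((-deriv α (p.1 - p.2) - deriv β (p.1 + p.2)) * V p.2
          + (α (p.1 - p.2) - β (p.1 + p.2)) * deriv V p.2) * ψ p.1 p.2 ^ 2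
        + (α (p.1 - p.2) - β (p.1 + p.2)) * V p.2 * (2 * ψ p.1 p.2 * ψx p.1 p.2))
    fun_prop
  have hS_cont : Continuous (Function.uncurry S) := by
    show Continuous fun p : ℝ × ℝ => (2 * (deriv α (p.1 - p.2) + deriv β (p.1 + p.2)) * V p.2
      + (β (p.1 + p.2) - α (p.1 - p.2)) * deriv V p.2) * ψ p.1 p.2 ^ 2
    fun_prop
  -- pointwise laws `∂_τ E = G + S`, `∂ₓ M = G`
  have hEd : ∀ x τ, HasDerivAt (fun τ => E τ x) (G τ x + S τ x) τ := by
    intro x τ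
    have h := hasDerivAt_nullEnergy_fst (V := V) hαd hβd h1 h3' h4 τ x
    refine h.congr_deriv ?_
    simp only [hG_def, hS_def]
    ring
  have hMd : ∀ τ x, HasDerivAt (fun y => M τ y) (G τ x) x := by
    intro τ x
    exact hasDerivAt_nullMomentum_snd hVd hαd hβd h2 h5 h6 τ x
  have key := trapezoid_divergence_identity hE_cont hM_cont hG_cont hS_cont hEd hMd hst hab
  -- identify the edge integrands
  have hA : (∫ x in (a + s)..(a + t), (E (x - a) x + M (x - a) x))
      = ∫ x in (a + s)..(a + t), (2 * β (2 * x - a) * (ψt (x - a) x + ψx (x - a) x) ^ 2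
          + 2 * α (-a) * V x * ψ (x - a) x ^ 2) := by
    refine integral_congr fun x _ => ?_
    simp only [hE_def, hM_def]
    rw [show x - a + x = 2 * x - a by ring, show x - a - x = -a by ring]
    ring
  have hC : (∫ x in (b - t)..(b - s), (E (b - x) x - M (b - x) x))
      = ∫ x in (b - t)..(b - s), (2 * α (b - 2 * x) * (ψt (b - x) x - ψx (b - x) x) ^ 2
          + 2 * β b * V x * ψ (b - x) x ^ 2) := by
    refine integral_congr fun x _ => ?_
    simp only [hE_def, hM_def]
    rw [show b - x + x = b by ring, show b - x - x = b - 2 * x by ring]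
    ring
  rw [hA, hC] at key
  simpa only [hE_def, hS_def] using key

end Solutions

end Literature.Analysis.PDE
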